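import Mathlib

/-!
# Block pivots: a positive-definite leading block and a positive-definite Schur complement make the
whole block matrix positive definite (instab g11, cell `ns-blowup`, 2026-08-26)

HONEST FRAMING (human ruling D-0035): nothing here is a claim about Navier–Stokes blow-up.
WHAT THIS IS NOT: not NS evidence. This is the MATRIX-VALUED pivot step that the cell's D2 / PART-4
ball certificates print («block LDLᵀ of N = −Herm(G(A^w − ω)): all block pivots > 0 ⇒ certificate
shape holds», `instab/INSTAB-BRIDGE.md` §11 l.109, §12 (L4′)); the scalar comparison chain is
`LyapunovSkewCutSemigroup.sum_nonpos_of_pivots_pos` (p416235). Mathlib has the positive-SEMIdefinite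
characterisation `Matrix.PosSemidef.fromBlocks₁₁`, and the tree has the CONVERSE strict direction
(`Literature.LinearAlgebra.Matrix.FischerInequality`'s `posDef_schur_of_posDef_fromBlocks`: whole
`≻ 0` ⇒ Schur complement `≻ 0`); the direction below (Schur data ⇒ whole `≻ 0`) is what a
certificate of `N ≻ 0` uses, one block at a time (peel the leading block, recurse on the Schur
complement).

* `posDef_fromBlocks_of_schur` — `A ≻ 0` and `D − Bᴴ A⁻¹ B ≻ 0` imply `[[A, B], [Bᴴ, D]] ≻ 0`.
* `dotProduct_mulVec_fromBlocks_pos` — the same as a strict inequality on the quadratic form of a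
  non-zero block vector (the form the recursion consumes).

Mathlib only; no new definitions.
-/

namespace Summit.NavierStokesRegularity.FluidComputer.BlockSchurPosDef

open Matrix
open scoped ComplexOrder

variable {m n 𝕜 : Type*} [Fintype m] [Fintype n] [DecidableEq m] [RCLike 𝕜]

/-- **Block pivot step.** If the leading block `A` is positive definite and the Schur complement
`D − Bᴴ A⁻¹ B` is positive definite, then the Hermitian block matrix `[[A, B], [Bᴴ, D]]` is positive
definite. (Completing the square: `z* N z = (x + A⁻¹By)* A (x + A⁻¹By) + y* (D − Bᴴ A⁻¹ B) y` for
`z = (x, y)`; the first term is `≥ 0`, the second `> 0` unless `y = 0`, and then the first is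
`x* A x > 0` unless also `x = 0`.) -/
theorem posDef_fromBlocks_of_schur {A : Matrix m m 𝕜} (B : Matrix m n 𝕜) {D : Matrix n n 𝕜}
    (hA : A.PosDef) (hS : (D - Bᴴ * A⁻¹ * B).PosDef) :
    (Matrix.fromBlocks A B Bᴴ D).PosDef := by
  letI : Invertible A := hA.isUnit.invertible
  rw [posDef_iff_dotProduct_mulVec]
  refine ⟨(IsHermitian.fromBlocks₁₁ B D hA.isHermitian).2 hS.isHermitian, fun z hz => ?_⟩
  obtain ⟨x, y, rfl⟩ : ∃ x y, z = Sum.elim x y :=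
    ⟨z ∘ Sum.inl, z ∘ Sum.inr, (Sum.elim_comp_inl_inr z).symm⟩
  rw [dotProduct_mulVec, schur_complement_eq₁₁ B D x y hA.isHermitian]
  have h1 : 0 ≤ star (x + (A⁻¹ * B) *ᵥ y) ᵥ* A ⬝ᵥ (x + (A⁻¹ * B) *ᵥ y) := by
    rw [← dotProduct_mulVec]
    exact (posSemidef_iff_dotProduct_mulVec.mp hA.posSemidef).2 _
  by_cases hy : y = 0
  · subst hy
    have hx : x ≠ 0 := by
      intro hx; apply hz
      funext i; cases i with
      | inl i => simp [hx]
      | inr i => simp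
    have h3 : 0 < star x ᵥ* A ⬝ᵥ x := by
      rw [← dotProduct_mulVec]; exact (posDef_iff_dotProduct_mulVec.mp hA).2 hx
    simpa using h3
  · have h2 : 0 < star y ᵥ* (D - Bᴴ * A⁻¹ * B) ⬝ᵥ y := by
      rw [← dotProduct_mulVec]; exact (posDef_iff_dotProduct_mulVec.mp hS).2 hy
    exact add_pos_of_nonneg_of_pos h1 h2

/-- **The strict quadratic-form inequality the recursion consumes.** Under the hypotheses of
`posDef_fromBlocks_of_schur`, every non-zero block vector `z` has `0 < z* [[A, B], [Bᴴ, D]] z`. -/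
theorem dotProduct_mulVec_fromBlocks_pos {A : Matrix m m 𝕜} (B : Matrix m n 𝕜) {D : Matrix n n 𝕜}
    (hA : A.PosDef) (hS : (D - Bᴴ * A⁻¹ * B).PosDef) {z : m ⊕ n → 𝕜} (hz : z ≠ 0) :
    0 < star z ⬝ᵥ (Matrix.fromBlocks A B Bᴴ D *ᵥ z) :=
  (posDef_iff_dotProduct_mulVec.mp (posDef_fromBlocks_of_schur B hA hS)).2 hz

end Summit.NavierStokesRegularity.FluidComputer.BlockSchurPosDef
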